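import Summits.ResolutionOfSingularities.ResolutionOfSingularities.Theorems.ShadowGameWin.Negative.Mirror

/-!
# `ShadowGameWin` (crux stmt-ResolutionOfSingularities-16159), negative side — part 2 (theorems
# only): the translation move, the `F`-order, and B's trap in `SG_3(2)` over `𝔽₃`

`tr_pair_mono`: in the chart `u` of the point blow-up the translation `v ↦ v + τ_v` sends `c·uᵃvᵇ`
(with `b ≤ a + s`, always true after blow-up and division) to `Σ_d C(b, d) τ_v^(b−d) c·uᵃvᵈ`;
`tr_pair_fsum` is the list form.  `mF_eq` / `mF_lt` compute the `F`-order (`Nat.sInf`) from an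
exhibited minimiser; `step_singleton`: a singleton centre is the identity on a clean series of
order `< 3` in that variable.  Then, for the six states of `Mirror.cycle`
(`S0 = v²+u³v+u³v²`, `S1 = u²v²+u⁴v+u⁵v²`, `S2 = uv²+u²v+u⁴v²`, `S3 = v²+2u³v+u³v²`,
`S4 = u²v²+2u⁴v+u⁵v²`, `S5 = uv²+2u²v+u⁴v²`): they are clean, their `{u,v}`-orders are
`2, 4, 3, 2, 4, 3` (divisions `s = 0, 3, 3, 0, 3, 3`), their `u`- and `v`-orders are `< 3`, the six
productive transitions `S_k → S_(k+1)` (point blow-up, chart `u`, `τ_v = 0,0,1,0,0,2`) hold — each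
closed by `decide` after the symbolic list calculus — and none of them is terminal.  Transcribed
independently in Python by three seats (refuter-rreview-0816T17-5-0,
planner-skel-stmt-ResolutionOfSingularities-16159-0, this seat) before this kernel check.
Refuter seat refuter-rattack-stmt-ResolutionOfSingularities-16159-0, 2026-08-17.
-/

noncomputable section

set_option linter.dupNamespace false

namespace Summit.ResolutionOfSingularities.ResolutionOfSingularities.Theorems.ShadowGameWin.Negative

section Translate

variable {n : ℕ} {κ : Type} [Field κ]

/-! ## Translation of a monomial in the chart `u` of the point blow-up (n = 2) -/

/-- Translation `v ↦ v + τ_v` (chart `u` of the point blow-up) on a monomial `u^a v^b` with `b ≤ a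
+ s`: the binomial expansion, as a closed-form coefficient function. [folklore] -/
theorem tr_pair_mono (τ : Fin 2 → κ) (s : ℕ) (e : ℕ × ℕ) (v : κ) (he : e.2 ≤ e.1 + s) :
    tr ({0, 1} : Finset (Fin 2)) 0 τ s (mono e v) =
      fun B => if B 0 = e.1 ∧ B 1 ≤ e.2 then
        v * (((Nat.choose e.2 (B 1) : ℕ) : κ) * τ 1 ^ (e.2 - B 1)) else 0 := by
  funext B
  unfold tr
  rw [erase_pair]
  by_cases hB : B 0 = e.1 ∧ B 1 ≤ e.2
  · rw [if_pos hB]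
    rw [Finset.sum_eq_single (![0, e.2 - B 1] : Fin 2 → ℕ)]
    · have hcond : ∀ j : Fin 2, j ∉ ({1} : Finset (Fin 2)) →
          (![0, e.2 - B 1] : Fin 2 → ℕ) j = 0 := by
        intro j hj
        rw [Finset.mem_singleton] at hj
        rcases Fin.eq_zero_or_eq_succ j with rfl | ⟨k, rfl⟩
        · rfl
        · exact absurd (by simpa using Fin.eq_zero k ▸ rfl) hj
      rw [if_pos hcond, Finset.prod_singleton]
      unfold mono
      simp only [Pi.add_apply, Matrix.cons_val_zero, Matrix.cons_val_one, add_zero]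
      rw [if_pos ⟨hB.1, by omega⟩, show B 1 + (e.2 - B 1) = e.2 by omega]
    · intro D _ hne
      by_cases h0 : ∀ j : Fin 2, j ∉ ({1} : Finset (Fin 2)) → D j = 0
      · rw [if_pos h0]
        have hD0 : D 0 = 0 := h0 0 (by decide)
        unfold mono
        simp only [Pi.add_apply]
        rw [if_neg, zero_mul]
        rintro ⟨_, h2⟩
        exact hne (funext (Fin.forall_fin_two.mpr ⟨by simp [hD0], by simp; omega⟩))
      · rw [if_neg h0]
    · intro hnot
      exfalso
      apply hnot
      rw [Fintype.mem_piFinset]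
      refine Fin.forall_fin_two.mpr ⟨?_, ?_⟩
      · simp
      · simp only [Matrix.cons_val_one, Matrix.cons_val_zero, Finset.mem_range]; omega
  · rw [if_neg hB]
    refine Finset.sum_eq_zero fun D _ => ?_
    by_cases h0 : ∀ j : Fin 2, j ∉ ({1} : Finset (Fin 2)) → D j = 0
    · rw [if_pos h0]
      have hD0 : D 0 = 0 := h0 0 (by decide)
      unfold mono
      simp only [Pi.add_apply]
      rw [if_neg, zero_mul]
      rintro ⟨h1, h2⟩
      exact hB ⟨by omega, by omega⟩
    · rw [if_neg h0]

/-- The list `[(a,0), …, (a,m)]` with coefficients `g d` sums to the closed-form function of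
`tr_pair_mono`. [folklore] -/
theorem fsum_range (a m : ℕ) (g : ℕ → κ) :
    fsum ((List.range (m + 1)).map fun d => ((a, d), g d)) =
      fun B => if B 0 = a ∧ B 1 ≤ m then g (B 1) else 0 := by
  induction m with
  | zero =>
    funext B
    rw [List.range_succ, List.range_zero, List.nil_append, List.map_cons, List.map_nil, fsum_cons,
      fsum_nil]
    simp only [Pi.add_apply, Pi.zero_apply, add_zero]
    unfold mono
    by_cases h : B 0 = a ∧ B 1 = 0
    · rw [if_pos h, if_pos ⟨h.1, h.2.le⟩, h.2]
    · rw [if_neg h, if_neg (fun h' => h ⟨h'.1, Nat.le_zero.mp h'.2⟩)]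
  | succ m ih =>
    funext B
    rw [List.range_succ, List.map_append, fsum_append, ih, List.map_cons, List.map_nil, fsum_cons,
      fsum_nil]
    simp only [Pi.add_apply, add_zero]
    unfold mono
    by_cases h1 : B 0 = a ∧ B 1 ≤ m
    · rw [if_pos h1, if_neg (fun h' => absurd (h'.2 ▸ h1.2) (by omega)), if_pos ⟨h1.1, by omega⟩,
        add_zero]
    · rw [if_neg h1, zero_add]
      by_cases h2 : B 0 = a ∧ B 1 = m + 1
      · rw [if_pos h2, if_pos ⟨h2.1, h2.2.le⟩, h2.2]
      · rw [if_neg h2, if_neg (fun h' => ?_)]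
        rcases Nat.lt_or_ge (B 1) (m + 1) with h3 | h3
        · exact h1 ⟨h'.1, by omega⟩
        · exact h2 ⟨h'.1, by omega⟩

/-- Translation on a monomial, list form. [folklore] -/
theorem tr_pair_mono' (τ : Fin 2 → κ) (s : ℕ) (e : ℕ × ℕ) (v : κ) (he : e.2 ≤ e.1 + s) :
    tr ({0, 1} : Finset (Fin 2)) 0 τ s (mono e v) =
      fsum ((List.range (e.2 + 1)).map fun d =>
        ((e.1, d), v * (((Nat.choose e.2 d : ℕ) : κ) * τ 1 ^ (e.2 - d)))) := by
  rw [tr_pair_mono τ s e v he, fsum_range]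

/-- Translation on a finite sum of monomials, list form (`flatMap` of binomial expansions).
[folklore] -/
theorem tr_pair_fsum (τ : Fin 2 → κ) (s : ℕ) (L : List ((ℕ × ℕ) × κ))
    (hL : ∀ x ∈ L, x.1.2 ≤ x.1.1 + s) :
    tr ({0, 1} : Finset (Fin 2)) 0 τ s (fsum L) =
      fsum (L.flatMap fun x => (List.range (x.1.2 + 1)).map fun d =>
        ((x.1.1, d), x.2 * (((Nat.choose x.1.2 d : ℕ) : κ) * τ 1 ^ (x.1.2 - d)))) := by
  induction L with
  | nil => rw [fsum_nil, tr_zero]; rfl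
  | cons x L ih =>
    rw [fsum_cons, tr_add, tr_pair_mono' τ s x.1 x.2 (hL x (by simp)),
      ih (fun y hy => hL y (by simp [hy])), List.flatMap_cons, fsum_append]

/-! ## The `F`-order; singleton centres -/

/-- The `F`-order is computed by exhibiting a minimiser (`sInf` characterisation). [folklore] -/
theorem mF_eq (F : Finset (Fin n)) (c : (Fin n → ℕ) → κ) (m₀ : ℕ) (A₀ : Fin n → ℕ) (h₀ : c A₀ ≠ 0)
    (hm₀ : Finset.sum F (fun j => A₀ j) = m₀)
    (hmin : ∀ A, c A ≠ 0 → m₀ ≤ Finset.sum F (fun j => A j)) : mF F c = m₀ := by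
  unfold mF
  apply le_antisymm
  · exact Nat.sInf_le ⟨A₀, h₀, hm₀.symm⟩
  · exact le_csInf ⟨m₀, A₀, h₀, hm₀.symm⟩ (by rintro m ⟨A, hA, rfl⟩; exact hmin A hA)

/-- An upper bound for the `F`-order from one support point. [folklore] -/
theorem mF_lt (F : Finset (Fin n)) (c : (Fin n → ℕ) → κ) (A₀ : Fin n → ℕ) (h₀ : c A₀ ≠ 0) (b : ℕ)
    (hb : Finset.sum F (fun j => A₀ j) < b) : mF F c < b :=
  lt_of_le_of_lt (Nat.sInf_le ⟨A₀, h₀, rfl⟩) hb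

/-- A singleton centre `{u_i}` is the identity on a clean series of `u_i`-order `< 3` (no
division, no translation). [folklore] -/
theorem step_singleton (i : Fin 2) (τ : Fin 2 → κ) (c : (Fin 2 → ℕ) → κ) (hc : clean 3 c = c)
    (hm : mF ({i} : Finset (Fin 2)) c < 3) : step 3 {i} i τ c = c := by
  unfold step
  rw [hc, Nat.div_eq_of_lt hm, mul_zero, bl_self _ _ (Finset.erase_singleton i), dv_zero',
    tr_self _ _ (Finset.erase_singleton i), hc]

end Translate

/-! ## The six states are clean; their orders -/

/-- State 0 is clean. [folklore] -/
theorem clean_S0 : clean 3 S0 = S0 := by rw [clean_fsum]; rfl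

/-- State 1 is clean. [folklore] -/
theorem clean_S1 : clean 3 S1 = S1 := by rw [clean_fsum]; rfl

/-- State 2 is clean. [folklore] -/
theorem clean_S2 : clean 3 S2 = S2 := by rw [clean_fsum]; rfl

/-- State 3 is clean. [folklore] -/
theorem clean_S3 : clean 3 S3 = S3 := by rw [clean_fsum]; rfl

/-- State 4 is clean. [folklore] -/
theorem clean_S4 : clean 3 S4 = S4 := by rw [clean_fsum]; rfl

/-- State 5 is clean. [folklore] -/
theorem clean_S5 : clean 3 S5 = S5 := by rw [clean_fsum]; rfl

/-- Every state of the trap is clean. [folklore] -/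
theorem clean_of_inCycle {c : (Fin 2 → ℕ) → ZMod 3} (hc : c ∈ cycle) : clean 3 c = c := by
  rcases (mem_cycle_iff c).mp hc with rfl | rfl | rfl | rfl | rfl | rfl
  exacts [clean_S0, clean_S1, clean_S2, clean_S3, clean_S4, clean_S5]

/-- `Σ_{j ∈ {u,v}} A j = A u + A v`. [folklore] -/
theorem sum_pair (A : Fin 2 → ℕ) :
    Finset.sum ({0, 1} : Finset (Fin 2)) (fun j => A j) = A 0 + A 1 :=
  Finset.sum_pair (by decide)

/-- Order of state 0 is `2` (so `s = 0`). [folklore] -/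
theorem mF_pair_S0 : mF ({0, 1} : Finset (Fin 2)) S0 = 2 := by
  refine mF_eq _ _ 2 ![0, 2] (by decide) (by rw [sum_pair]; rfl) fun A hA => ?_
  have hk := mem_keys_of_ne_zero _ _ hA
  rw [sum_pair]
  simp [L0] at hk
  omega

/-- Order of state 1 is `4` (so `s = 3`). [folklore] -/
theorem mF_pair_S1 : mF ({0, 1} : Finset (Fin 2)) S1 = 4 := by
  refine mF_eq _ _ 4 ![2, 2] (by decide) (by rw [sum_pair]; rfl) fun A hA => ?_
  have hk := mem_keys_of_ne_zero _ _ hA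
  rw [sum_pair]
  simp [L1] at hk
  omega

/-- Order of state 2 is `3` (so `s = 3`). [folklore] -/
theorem mF_pair_S2 : mF ({0, 1} : Finset (Fin 2)) S2 = 3 := by
  refine mF_eq _ _ 3 ![1, 2] (by decide) (by rw [sum_pair]; rfl) fun A hA => ?_
  have hk := mem_keys_of_ne_zero _ _ hA
  rw [sum_pair]
  simp [L2] at hk
  omega

/-- Order of state 3 is `2` (so `s = 0`). [folklore] -/
theorem mF_pair_S3 : mF ({0, 1} : Finset (Fin 2)) S3 = 2 := by
  refine mF_eq _ _ 2 ![0, 2] (by decide) (by rw [sum_pair]; rfl) fun A hA => ?_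
  have hk := mem_keys_of_ne_zero _ _ hA
  rw [sum_pair]
  simp [L3] at hk
  omega

/-- Order of state 4 is `4` (so `s = 3`). [folklore] -/
theorem mF_pair_S4 : mF ({0, 1} : Finset (Fin 2)) S4 = 4 := by
  refine mF_eq _ _ 4 ![2, 2] (by decide) (by rw [sum_pair]; rfl) fun A hA => ?_
  have hk := mem_keys_of_ne_zero _ _ hA
  rw [sum_pair]
  simp [L4] at hk
  omega

/-- Order of state 5 is `3` (so `s = 3`). [folklore] -/
theorem mF_pair_S5 : mF ({0, 1} : Finset (Fin 2)) S5 = 3 := by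
  refine mF_eq _ _ 3 ![1, 2] (by decide) (by rw [sum_pair]; rfl) fun A hA => ?_
  have hk := mem_keys_of_ne_zero _ _ hA
  rw [sum_pair]
  simp [L5] at hk
  omega

/-- The `u`-order of every state is `< 3`. [folklore] -/
theorem mF0_lt {c : (Fin 2 → ℕ) → ZMod 3} (hc : c ∈ cycle) : mF ({0} : Finset (Fin 2)) c < 3 := by
  rcases (mem_cycle_iff c).mp hc with rfl | rfl | rfl | rfl | rfl | rfl
  · exact mF_lt _ _ ![0, 2] (by decide) 3 (by decide)
  · exact mF_lt _ _ ![2, 2] (by decide) 3 (by decide)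
  · exact mF_lt _ _ ![1, 2] (by decide) 3 (by decide)
  · exact mF_lt _ _ ![0, 2] (by decide) 3 (by decide)
  · exact mF_lt _ _ ![2, 2] (by decide) 3 (by decide)
  · exact mF_lt _ _ ![1, 2] (by decide) 3 (by decide)

/-- The `v`-order of every state is `< 3`. [folklore] -/
theorem mF1_lt {c : (Fin 2 → ℕ) → ZMod 3} (hc : c ∈ cycle) : mF ({1} : Finset (Fin 2)) c < 3 := by
  rcases (mem_cycle_iff c).mp hc with rfl | rfl | rfl | rfl | rfl | rfl
  · exact mF_lt _ _ ![3, 1] (by decide) 3 (by decide)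
  · exact mF_lt _ _ ![4, 1] (by decide) 3 (by decide)
  · exact mF_lt _ _ ![2, 1] (by decide) 3 (by decide)
  · exact mF_lt _ _ ![3, 1] (by decide) 3 (by decide)
  · exact mF_lt _ _ ![4, 1] (by decide) 3 (by decide)
  · exact mF_lt _ _ ![2, 1] (by decide) 3 (by decide)

/-! ## The six productive moves (point blow-up, chart `u`, B’s translation) -/

/-- Transition `S0 → S1` (τ = 0). [folklore] -/
theorem step_S0 : step 3 ({0, 1} : Finset (Fin 2)) 0 (fun _ => (0 : ZMod 3)) S0 = S1 := by
  unfold step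
  rw [clean_S0, mF_pair_S0, show (3 : ℕ) * (2 / 3) = 0 from rfl, bl_pair_fsum, dv0_fsum,
    tr_pair_fsum _ _ _ (by decide), clean_fsum]
  exact fsum_ext _ _ (by decide)

/-- Transition `S1 → S2` (τ = 0). [folklore] -/
theorem step_S1 : step 3 ({0, 1} : Finset (Fin 2)) 0 (fun _ => (0 : ZMod 3)) S1 = S2 := by
  unfold step
  rw [clean_S1, mF_pair_S1, show (3 : ℕ) * (4 / 3) = 3 from rfl, bl_pair_fsum, dv0_fsum,
    tr_pair_fsum _ _ _ (by decide), clean_fsum]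
  exact fsum_ext _ _ (by decide)

/-- Transition `S2 → S3` (τ = 1: B moves to the other root of `v(v+1)`, cancelling the degree-1
monomial). [folklore] -/
theorem step_S2 : step 3 ({0, 1} : Finset (Fin 2)) 0 (fun _ => (1 : ZMod 3)) S2 = S3 := by
  unfold step
  rw [clean_S2, mF_pair_S2, show (3 : ℕ) * (3 / 3) = 3 from rfl, bl_pair_fsum, dv0_fsum,
    tr_pair_fsum _ _ _ (by decide), clean_fsum]
  exact fsum_ext _ _ (by decide)

/-- Transition `S3 → S4` (τ = 0). [folklore] -/
theorem step_S3 : step 3 ({0, 1} : Finset (Fin 2)) 0 (fun _ => (0 : ZMod 3)) S3 = S4 := by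
  unfold step
  rw [clean_S3, mF_pair_S3, show (3 : ℕ) * (2 / 3) = 0 from rfl, bl_pair_fsum, dv0_fsum,
    tr_pair_fsum _ _ _ (by decide), clean_fsum]
  exact fsum_ext _ _ (by decide)

/-- Transition `S4 → S5` (τ = 0). [folklore] -/
theorem step_S4 : step 3 ({0, 1} : Finset (Fin 2)) 0 (fun _ => (0 : ZMod 3)) S4 = S5 := by
  unfold step
  rw [clean_S4, mF_pair_S4, show (3 : ℕ) * (4 / 3) = 3 from rfl, bl_pair_fsum, dv0_fsum,
    tr_pair_fsum _ _ _ (by decide), clean_fsum]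
  exact fsum_ext _ _ (by decide)

/-- Transition `S5 → S0` (τ = 2), closing the cycle. [folklore] -/
theorem step_S5 : step 3 ({0, 1} : Finset (Fin 2)) 0 (fun _ => (2 : ZMod 3)) S5 = S0 := by
  unfold step
  rw [clean_S5, mF_pair_S5, show (3 : ℕ) * (3 / 3) = 3 from rfl, bl_pair_fsum, dv0_fsum,
    tr_pair_fsum _ _ _ (by decide), clean_fsum]
  exact fsum_ext _ _ (by decide)

/-! ## Non-terminality of the trap -/

/-- Decidable criterion for NON-terminality of a clean finite sum of monomials: non-zero, no
monomial of degree `≤ 1`, no least exponent. [folklore] -/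
theorem not_terminal_fsum (L : List ((ℕ × ℕ) × ZMod 3)) (hcl : clean 3 (fsum L) = fsum L)
    (x₀ : ℕ × ℕ) (hx₀ : fsumAt L x₀ ≠ 0)
    (h : ∀ k ∈ L.map Prod.fst, fsumAt L k ≠ 0 →
      1 < k.1 + k.2 ∧ ∃ k' ∈ L.map Prod.fst, fsumAt L k' ≠ 0 ∧ ¬ (k.1 ≤ k'.1 ∧ k.2 ≤ k'.2)) :
    ¬ ((∀ A, clean 3 (fsum L) A = 0) ∨ ∃ A, clean 3 (fsum L) A ≠ 0 ∧
        (Finset.sum Finset.univ (fun j => A j) ≤ 1 ∨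
          ∀ B, clean 3 (fsum L) B ≠ 0 → ∀ j, A j ≤ B j)) := by
  rw [hcl]
  rintro (h0 | ⟨A, hA, hT⟩)
  · apply hx₀
    simpa [fsum_apply] using h0 ![x₀.1, x₀.2]
  · have hk := mem_keys_of_ne_zero L A hA
    rw [fsum_apply] at hA
    obtain ⟨hdeg, k', -, hk'0, hnle⟩ := h _ hk hA
    rcases hT with hT | hT
    · rw [Fin.sum_univ_two] at hT
      exact absurd hT (by simpa using hdeg)
    · apply hnle
      have := hT ![k'.1, k'.2] (by rw [fsum_apply]; simpa using hk'0)
      exact ⟨by simpa using this 0, by simpa using this 1⟩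

/-- No state of the trap is terminal. [folklore] -/
theorem not_terminal_of_inCycle {c : (Fin 2 → ℕ) → ZMod 3} (hc : c ∈ cycle) :
    ¬ ((∀ A, clean 3 c A = 0) ∨ ∃ A, clean 3 c A ≠ 0 ∧
        (Finset.sum Finset.univ (fun j => A j) ≤ 1 ∨ ∀ B, clean 3 c B ≠ 0 → ∀ j, A j ≤ B j)) := by
  rcases (mem_cycle_iff c).mp hc with rfl | rfl | rfl | rfl | rfl | rfl
  · exact not_terminal_fsum L0 clean_S0 (0, 2) (by decide) (by decide)
  · exact not_terminal_fsum L1 clean_S1 (2, 2) (by decide) (by decide)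
  · exact not_terminal_fsum L2 clean_S2 (1, 2) (by decide) (by decide)
  · exact not_terminal_fsum L3 clean_S3 (0, 2) (by decide) (by decide)
  · exact not_terminal_fsum L4 clean_S4 (2, 2) (by decide) (by decide)
  · exact not_terminal_fsum L5 clean_S5 (1, 2) (by decide) (by decide)

end Summit.ResolutionOfSingularities.ResolutionOfSingularities.Theorems.ShadowGameWin.Negative

end
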